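import Mathlib
import Literature.NumberTheory.DiophantineGeometry.PartitionTableaux
import Literature.NumberTheory.DiophantineGeometry.StandardFillings
import Literature.RepresentationTheory.FiniteGroups.VershikKerovBoundaryWord

/-!
# Standard tableaux of Young diagrams: transposition, corners and the branching inequalities

Helper file 1/2 of the quadratic lower bound for Specht dimensions used by the LEVEL-ONE programme on
the crux `SnSubsetDichotomy.PolynomialSlack` (stmt-MatrixMultiplication-8306). Writing `f^Y` for the
number of standard fillings of a Young diagram `Y` by `|Y|` entries (`StdFilling`, so that
`numStandardTableaux μ = f^{μ.youngDiagram}`):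

* `exists_partition_youngDiagram_eq` — every diagram is the diagram of a partition (parts = row
  lengths), hence `1 ≤ f^Y` (`one_le_card_stdFilling`);
* `card_stdFilling_transpose`, `numStandardTableaux_transpose` — `f^{Yᵀ} = f^Y`, `f^{μ'} = f^μ`;
* `le_syt_of_isCornerRow`, `add_le_syt_of_isCornerRow` — the branching INEQUALITIES `f^{Y ⊖ c} ≤ f^Y`
  and `f^{Y ⊖ c} + f^{Y ⊖ c'} ≤ f^Y` for corners `c ≠ c'` (from the tree's branching rule
  `StdFilling.card_stdFilling_succ`), where the corner of a row `r` with `rowLen (r+1) < rowLen r` is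
  the cell `(r, rowLen r - 1)`;
* bookkeeping on first row / first column / size of `Y` and of `Y ⊖ c`.

Reference for the branching rule: G. James, *The Representation Theory of the Symmetric Groups*,
LNM 682 (1978), §9; W. Fulton, *Young Tableaux* (1997), §7.2.
-/

namespace Summit.MatrixMultiplication.MatrixMultiplication.Theorems.PolynomialSlack

open Literature.NumberTheory.DiophantineGeometry Literature.RepresentationTheory.FiniteGroups

-- `Summit.<Summit>.<Problem>` is the tree's mandated summit-side namespace (CONVENTIONS §2); for
-- this single-conjunct summit the two coincide, so each declaration silences `dupNamespace`.
set_option linter.dupNamespace false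

/-! ## Young diagrams as partitions; the number of standard tableaux of a diagram -/

/-- Every Young diagram is the diagram of a partition of its size (parts = row lengths), with as
many parts as the first column has cells. [folklore] -/
theorem exists_partition_youngDiagram_eq (Y : YoungDiagram) :
    ∃ μ : Nat.Partition Y.cells.card, μ.youngDiagram = Y ∧ μ.parts.card = Y.colLen 0 := by
  let μ : Nat.Partition Y.cells.card :=
    { parts := (Y.rowLens : Multiset ℕ)
      parts_pos := fun h => Y.pos_of_mem_rowLens _ (Multiset.mem_coe.mp h)
      parts_sum := by rw [Multiset.sum_coe, YoungDiagram.sum_rowLens] }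
  have hsorted : μ.sortedParts = Y.rowLens := by
    change Multiset.sort (Y.rowLens : Multiset ℕ) (· ≥ ·) = _
    rw [Multiset.coe_sort]
    exact List.mergeSort_eq_self _ (YoungDiagram.rowLens_sorted _).pairwise
  have key : ∀ (l₁ l₂ : List ℕ) (h₁ : l₁.SortedGE) (h₂ : l₂.SortedGE), l₁ = l₂ →
      YoungDiagram.ofRowLens l₁ h₁ = YoungDiagram.ofRowLens l₂ h₂ := by
    rintro l₁ l₂ h₁ h₂ rfl; rfl
  refine ⟨μ, (key _ _ _ (YoungDiagram.rowLens_sorted _) hsorted).trans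
    YoungDiagram.ofRowLens_to_rowLens_eq_self, ?_⟩
  change (Y.rowLens : Multiset ℕ).card = _
  rw [Multiset.coe_card, YoungDiagram.length_rowLens]

/-- `f^μ` is the number of standard fillings of the diagram of `μ` by `|diagram|` entries. [folklore] -/
theorem numStandardTableaux_eq_card_stdFilling' {d : ℕ} (μ : Nat.Partition d) :
    numStandardTableaux μ = Nat.card (StdFilling μ.youngDiagram.cells.card μ.youngDiagram) := by
  rw [numStandardTableaux_eq_card_stdFilling, μ.card_cells_youngDiagram]

/-- Every diagram has a standard tableau. [folklore] -/
theorem one_le_card_stdFilling (Y : YoungDiagram) : 1 ≤ Nat.card (StdFilling Y.cells.card Y) := by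
  obtain ⟨μ, hμ, -⟩ := exists_partition_youngDiagram_eq Y
  have h := numStandardTableaux_pos_holds μ
  rwa [numStandardTableaux_eq_card_stdFilling', hμ] at h

/-! ## Transposition -/

/-- **`f^{λ'} = f^{λ}`**: transposing standard fillings (swap the coordinates of every entry) is a
bijection, so `Yᵀ` has as many standard fillings as `Y`. [folklore] -/
theorem card_stdFilling_transpose (n : ℕ) (Y : YoungDiagram) :
    Nat.card (StdFilling n Y.transpose) = Nat.card (StdFilling n Y) := by
  refine (Nat.card_congr (?_ : StdFilling n Y ≃ StdFilling n Y.transpose)).symm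
  exact
    { toFun := fun T => ⟨fun p => (T.1 p).swap,
        ⟨fun p => YoungDiagram.mem_transpose.2 (by rw [Prod.swap_swap]; exact T.mem p),
          fun p q h => T.injective (Prod.swap_injective h),
          fun p q h hle => T.not_le h (Prod.swap_le_swap.1 hle)⟩⟩
      invFun := fun T => ⟨fun p => (T.1 p).swap,
        ⟨fun p => YoungDiagram.mem_transpose.1 (T.mem p),
          fun p q h => T.injective (Prod.swap_injective h),
          fun p q h hle => T.not_le h (Prod.swap_le_swap.1 hle)⟩⟩
      left_inv := fun T => by apply StdFilling.ext; funext p; simp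
      right_inv := fun T => by apply StdFilling.ext; funext p; simp }

/-- `f^{Yᵀ} = f^{Y}` with `|Yᵀ| = |Y|` entries. [folklore] -/
theorem card_stdFilling_transpose' (Y : YoungDiagram) :
    Nat.card (StdFilling Y.transpose.cells.card Y.transpose) = Nat.card (StdFilling Y.cells.card Y) := by
  rw [YoungDiagram.card_transpose, card_stdFilling_transpose]

/-- `f^{μ'} = f^{μ}` for partitions. [folklore] -/
theorem numStandardTableaux_transpose {d : ℕ} (μ : Nat.Partition d) :
    numStandardTableaux μ.transpose = numStandardTableaux μ := by
  rw [numStandardTableaux_eq_card_stdFilling', numStandardTableaux_eq_card_stdFilling',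
    μ.youngDiagram_transpose, card_stdFilling_transpose']

/-! ## Corners and the branching inequalities -/

/-- The corner cell of a corner row lies in the diagram. [folklore] -/
theorem cornerCell_mem {Y : YoungDiagram} {r : ℕ} (h : (Y.rowLen (r + 1) < Y.rowLen r)) : (r, Y.rowLen r - 1) ∈ Y.cells :=
  (YoungDiagram.mem_cells _).2 (YoungDiagram.mem_iff_lt_rowLen.2 (by omega))

/-- Removing a corner: the number of cells drops by one, so if `|Y| = n + 1` then `|Y ⊖ c| = n`.
[folklore] -/
theorem card_removeAbove_cornerCell {Y : YoungDiagram} {r n : ℕ} (h : (Y.rowLen (r + 1) < Y.rowLen r))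
    (hY : Y.cells.card = n + 1) : (Y.removeAbove ((r, Y.rowLen r - 1))).cells.card = n := by
  rw [YoungDiagram.card_removeAbove_corner h, hY]; rfl

/-- A diagram with a corner row is non-empty: `|Y| = n + 1` for some `n`. [folklore] -/
theorem exists_card_eq_succ_of_isCornerRow {Y : YoungDiagram} {r : ℕ} (h : (Y.rowLen (r + 1) < Y.rowLen r)) :
    ∃ n, Y.cells.card = n + 1 :=
  Nat.exists_eq_add_one_of_ne_zero (Finset.card_ne_zero_of_mem (cornerCell_mem h))

/-- **Branching inequality, one corner**: `f^{Y ⊖ c} ≤ f^{Y}` for a corner `c`. [folklore] -/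
theorem le_syt_of_isCornerRow {Y : YoungDiagram} {r : ℕ} (h : (Y.rowLen (r + 1) < Y.rowLen r)) :
    Nat.card (StdFilling (Y.removeAbove ((r, Y.rowLen r - 1))).cells.card (Y.removeAbove ((r, Y.rowLen r - 1)))) ≤ Nat.card (StdFilling Y.cells.card Y) := by
  classical
  obtain ⟨n, hY⟩ := exists_card_eq_succ_of_isCornerRow h
  have hbranch := StdFilling.card_stdFilling_succ n Y
  have e1 : Nat.card (StdFilling Y.cells.card Y) = Nat.card (StdFilling (n + 1) Y) := by rw [hY]
  have e2 : Nat.card (StdFilling (Y.removeAbove ((r, Y.rowLen r - 1))).cells.card (Y.removeAbove ((r, Y.rowLen r - 1)))) =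
      Nat.card (StdFilling n (Y.removeAbove ((r, Y.rowLen r - 1)))) := by
    rw [card_removeAbove_cornerCell h hY]
  rw [e1, e2, hbranch]
  exact Finset.single_le_sum (f := fun c => Nat.card (StdFilling n (Y.removeAbove c)))
    (fun _ _ => Nat.zero_le _) (cornerCell_mem h)

/-- **Branching inequality, two corners**: `f^{Y ⊖ c} + f^{Y ⊖ c'} ≤ f^{Y}` for corners in distinct rows.
[folklore] -/
theorem add_le_syt_of_isCornerRow {Y : YoungDiagram} {r r' : ℕ} (h : (Y.rowLen (r + 1) < Y.rowLen r))
    (h' : (Y.rowLen (r' + 1) < Y.rowLen r')) (hne : r ≠ r') :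
    Nat.card (StdFilling (Y.removeAbove ((r, Y.rowLen r - 1))).cells.card (Y.removeAbove ((r, Y.rowLen r - 1)))) + Nat.card (StdFilling (Y.removeAbove ((r', Y.rowLen r' - 1))).cells.card (Y.removeAbove ((r', Y.rowLen r' - 1)))) ≤ Nat.card (StdFilling Y.cells.card Y) := by
  classical
  obtain ⟨n, hY⟩ := exists_card_eq_succ_of_isCornerRow h
  have hbranch := StdFilling.card_stdFilling_succ n Y
  have e1 : Nat.card (StdFilling Y.cells.card Y) = Nat.card (StdFilling (n + 1) Y) := by rw [hY]
  have e2 : Nat.card (StdFilling (Y.removeAbove ((r, Y.rowLen r - 1))).cells.card (Y.removeAbove ((r, Y.rowLen r - 1)))) =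
      Nat.card (StdFilling n (Y.removeAbove ((r, Y.rowLen r - 1)))) := by
    rw [card_removeAbove_cornerCell h hY]
  have e3 : Nat.card (StdFilling (Y.removeAbove ((r', Y.rowLen r' - 1))).cells.card (Y.removeAbove ((r', Y.rowLen r' - 1)))) =
      Nat.card (StdFilling n (Y.removeAbove ((r', Y.rowLen r' - 1)))) := by
    rw [card_removeAbove_cornerCell h' hY]
  have hcc : (r, Y.rowLen r - 1) ≠ (r', Y.rowLen r' - 1) := fun e => hne (congrArg Prod.fst e)
  rw [e1, e2, e3, hbranch]
  have hsub : ({(r, Y.rowLen r - 1), (r', Y.rowLen r' - 1)} : Finset (ℕ × ℕ)) ⊆ Y.cells := by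
    intro c hc
    rcases Finset.mem_insert.1 hc with rfl | hc
    · exact cornerCell_mem h
    · rw [Finset.mem_singleton.1 hc]; exact cornerCell_mem h'
  calc Nat.card (StdFilling n (Y.removeAbove ((r, Y.rowLen r - 1)))) +
        Nat.card (StdFilling n (Y.removeAbove ((r', Y.rowLen r' - 1))))
      = ∑ c ∈ ({(r, Y.rowLen r - 1), (r', Y.rowLen r' - 1)} : Finset (ℕ × ℕ)),
          Nat.card (StdFilling n (Y.removeAbove c)) := by
        rw [Finset.sum_insert (by rwa [Finset.mem_singleton]), Finset.sum_singleton]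
    _ ≤ _ := Finset.sum_le_sum_of_subset_of_nonneg hsub fun _ _ _ => Nat.zero_le _

/-! ## Shape bookkeeping: first row, first column, size -/

section Shape

variable {Y : YoungDiagram}

/-- Rows above the first column length are non-empty. [folklore] -/
theorem one_le_rowLen_of_lt_colLen {r : ℕ} (h : r < Y.colLen 0) : 1 ≤ Y.rowLen r :=
  YoungDiagram.mem_iff_lt_rowLen.1 (YoungDiagram.mem_iff_lt_colLen.2 h)

/-- The last row is a corner row. [folklore] -/
theorem isCornerRow_last (h : 1 ≤ Y.colLen 0) : (Y.rowLen (Y.colLen 0 - 1 + 1) < Y.rowLen (Y.colLen 0 - 1)) := by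
  rw [VershikKerov.rowLen_eq_zero _ (by omega)]
  exact one_le_rowLen_of_lt_colLen (by omega)

/-- The size of a diagram is the sum of its row lengths over the rows `r < colLen 0`. [folklore] -/
theorem card_eq_sum_rowLen (Y : YoungDiagram) :
    Y.cells.card = ∑ r ∈ Finset.range (Y.colLen 0), Y.rowLen r := by
  rw [← YoungDiagram.sum_rowLens, YoungDiagram.rowLens, ← List.sum_toFinset _ (List.nodup_range),
    List.toFinset_range]

/-- A non-empty diagram has a non-empty first column. [folklore] -/
theorem one_le_colLen_of_card_pos (h : 0 < Y.cells.card) : 1 ≤ Y.colLen 0 := by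
  by_contra h0
  rw [card_eq_sum_rowLen, show Y.colLen 0 = 0 by omega, Finset.range_zero, Finset.sum_empty] at h
  exact lt_irrefl _ h

/-- A single-column diagram: if the first row has length `≤ 1` then `|Y| = colLen 0`. [folklore] -/
theorem card_eq_colLen_of_rowLen_le_one (h : Y.rowLen 0 ≤ 1) : Y.cells.card = Y.colLen 0 := by
  rw [card_eq_sum_rowLen]
  calc ∑ r ∈ Finset.range (Y.colLen 0), Y.rowLen r = ∑ r ∈ Finset.range (Y.colLen 0), 1 := by
        refine Finset.sum_congr rfl fun r hr => le_antisymm ?_ (one_le_rowLen_of_lt_colLen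
          (Finset.mem_range.1 hr))
        exact (Y.rowLen_anti 0 r (Nat.zero_le _)).trans h
    _ = Y.colLen 0 := by simp

/-- A single-row diagram: if the first column has length `≤ 1` then `|Y| = rowLen 0`. [folklore] -/
theorem card_eq_rowLen_of_colLen_le_one (h : Y.colLen 0 ≤ 1) : Y.cells.card = Y.rowLen 0 := by
  rw [card_eq_sum_rowLen]
  rcases Nat.eq_zero_or_pos (Y.colLen 0) with h0 | h0
  · rw [h0, Finset.range_zero, Finset.sum_empty, VershikKerov.rowLen_eq_zero _ (by omega)]
  · rw [show Y.colLen 0 = 1 by omega, Finset.sum_range_one]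

/-- In a rectangle-free-of-corners situation: if no row `r < colLen 0 - 1` is a corner row, all rows
have the length of the first row. [folklore] -/
theorem rowLen_eq_rowLen_zero_of_no_corner (h : ∀ r, r + 1 < Y.colLen 0 → ¬ (Y.rowLen (r + 1) < Y.rowLen r))
    {r : ℕ} (hr : r < Y.colLen 0) : Y.rowLen r = Y.rowLen 0 := by
  induction r with
  | zero => rfl
  | succ r ih =>
    have h1 := ih (by omega)
    have h2 : ¬ (Y.rowLen (r + 1) < Y.rowLen r) := h r (by omega)
    have h3 := Y.rowLen_anti r (r + 1) (Nat.le_succ r)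
    omega

/-- A rectangle: if every row `r < colLen 0` has length `rowLen 0` then `|Y| = rowLen 0 * colLen 0`.
[folklore] -/
theorem card_eq_mul_of_rect (h : ∀ r, r < Y.colLen 0 → Y.rowLen r = Y.rowLen 0) :
    Y.cells.card = Y.rowLen 0 * Y.colLen 0 := by
  rw [card_eq_sum_rowLen]
  calc ∑ r ∈ Finset.range (Y.colLen 0), Y.rowLen r
      = ∑ r ∈ Finset.range (Y.colLen 0), Y.rowLen 0 :=
        Finset.sum_congr rfl fun r hr => h r (Finset.mem_range.1 hr)
    _ = Y.rowLen 0 * Y.colLen 0 := by rw [Finset.sum_const, Finset.card_range, smul_eq_mul, mul_comm]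

/-- Row lengths are monotone in the diagram. [folklore] -/
theorem rowLen_le_of_le {Y Z : YoungDiagram} (h : Y ≤ Z) (i : ℕ) : Y.rowLen i ≤ Z.rowLen i := by
  by_contra hlt
  have hmem : (i, Z.rowLen i) ∈ Y := YoungDiagram.mem_iff_lt_rowLen.2 (by omega)
  exact absurd (YoungDiagram.mem_iff_lt_rowLen.1 (h hmem)) (lt_irrefl _)

/-- Column lengths are monotone in the diagram. [folklore] -/
theorem colLen_le_of_le {Y Z : YoungDiagram} (h : Y ≤ Z) (j : ℕ) : Y.colLen j ≤ Z.colLen j := by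
  by_contra hlt
  have hmem : (Z.colLen j, j) ∈ Y := YoungDiagram.mem_iff_lt_colLen.2 (by omega)
  exact absurd (YoungDiagram.mem_iff_lt_colLen.1 (h hmem)) (lt_irrefl _)

/-- `Y ⊖ c ≤ Y`. [folklore] -/
theorem removeAbove_le (Y : YoungDiagram) (c : ℕ × ℕ) : Y.removeAbove c ≤ Y :=
  fun _ hx => YoungDiagram.mem_of_mem_removeAbove hx

/-- Removing the corner of row `r` shortens row `r` by one. [folklore] -/
theorem rowLen_removeAbove_cornerCell_self {r : ℕ} (h : (Y.rowLen (r + 1) < Y.rowLen r)) :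
    (Y.removeAbove ((r, Y.rowLen r - 1))).rowLen r = Y.rowLen r - 1 :=
  YoungDiagram.rowLen_removeAbove_corner_self h

/-- Removing the corner of row `r` keeps the other rows. [folklore] -/
theorem rowLen_removeAbove_cornerCell_of_ne {r i : ℕ} (h : (Y.rowLen (r + 1) < Y.rowLen r)) (hi : i ≠ r) :
    (Y.removeAbove ((r, Y.rowLen r - 1))).rowLen i = Y.rowLen i :=
  YoungDiagram.rowLen_removeAbove_corner_of_ne h hi

end Shape

end Summit.MatrixMultiplication.MatrixMultiplication.Theorems.PolynomialSlack
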